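import Summits.RiemannHypothesis.RiemannHypothesis.Theorems.HandoffDodgerMomentRecursion
import Summits.RiemannHypothesis.RiemannHypothesis.Theorems.HandoffDodgerPowerSums
import HarnessLib

/-!
# HANDOFF — the moments of the dodger as COEFFICIENTS OF A FORMAL POWER SERIES (rh-explicit, track «HANDOFF», seat prove-2 gen9, ATTEMPT-18 §3 (R-3) D1 roadmap (δ′))

HONEST FRAMING. Nothing here bears on the truth of RH; this is algebra in `ℂ⟦X⟧`. With the reversed polynomials `Λ̃ = latticeRevPoly b T`,
`P̃ = nodeRevPoly T` and the constant `c_∞ = dodgerCinfC b T` of `HandoffDodgerMomentRecursion`, DEFINE the formal power series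

  `dodgerH b T := P̃ · Λ̃⁻¹ ∈ ℂ⟦X⟧`   (`Λ̃` is a unit: constant coefficient `1`),

with coefficients `h_n`. Then `Λ̃·H = P̃` (`latticeRevPoly_mul_dodgerH`), so `Σ_{i≤n} λ̃_i h_{n−i} = π̃_n` (`dodgerH_recursion`), and comparing with the
moment recursion `Σ_{i≤n} λ̃_i M_{n−i} = λ̃_n − c_∞π̃_n` (strong induction, `λ̃_0 = 1`):

  `M_0 = 1 − c_∞·h_0`,  `M_n = −c_∞·h_n` (n ≥ 1)     (`dodgerMoment_eq`, `dodgerMoment_succ_eq`; `h_0 = 1`).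

USE: the collar profile `2b·Re F₀(b−σ) = c_∞ + Σ_{n≥1}(−1)^{n+1}M_nσ^{2n}/(2n)! = c_∞·Σ_{n≥0} h_n(−σ²)ⁿ/(2n)!` is now governed by the
coefficients of ONE formal power series `H = P̃/Λ̃ = e^{−p₁X}·Π_ρE_{z_ρ²}^{m}·Π_kE_{ν_k}^{−1}` (`E_a = (1 − aX)e^{aX}`), on which the size step of
ATTEMPT-16's Lemma D1 is coefficient (majorant) bookkeeping — ATTEMPT-18 §3 (δ′). No `sorry`, standard axioms.

References: this track (ATTEMPT-18 §3 D1 roadmap).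

(Re-landed byte-identical apart from this line by seat prove-2 gen10, 2026-08-25T18:3xZ, to re-queue the module's build: the first accept was keyed to a host-less build stream.)
-/

set_option linter.dupNamespace false

noncomputable section

open Complex Finset

namespace Summit.RiemannHypothesis.RiemannHypothesis.Theorems.Handoff

open Literature.NumberTheory.LFunctions Literature.NumberTheory.LFunctions.SchoenfeldBound

/-- **The formal quotient** `H = P̃·Λ̃⁻¹ ∈ ℂ⟦X⟧`. [this track, ATTEMPT-18 §3 D1 (δ′)] -/
def dodgerH (b T : ℝ) : PowerSeries ℂ :=
  (nodeRevPoly T : PowerSeries ℂ) * ((latticeRevPoly b T : PowerSeries ℂ))⁻¹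

/-- `Λ̃` has constant coefficient `1` (so it is a unit of `ℂ⟦X⟧`). [folklore] -/
theorem constantCoeff_latticeRevPoly (b T : ℝ) :
    PowerSeries.constantCoeff ((latticeRevPoly b T : Polynomial ℂ) : PowerSeries ℂ) = 1 := by
  rw [Polynomial.constantCoeff_coe, coeff_latticeRevPoly_zero]

/-- `Λ̃·H = P̃` in `ℂ⟦X⟧`. [this track, ATTEMPT-18 §3 D1 (δ′)] -/
theorem latticeRevPoly_mul_dodgerH (b T : ℝ) :
    ((latticeRevPoly b T : Polynomial ℂ) : PowerSeries ℂ) * dodgerH b T = (nodeRevPoly T : Polynomial ℂ) := by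
  unfold dodgerH
  rw [mul_left_comm, PowerSeries.mul_inv_cancel _ (by rw [constantCoeff_latticeRevPoly]; exact one_ne_zero), mul_one]

/-- The coefficient recursion of `H`: `Σ_{i≤n} λ̃_i·h_{n−i} = π̃_n`. [folklore] -/
theorem dodgerH_recursion (b T : ℝ) (n : ℕ) :
    ∑ i ∈ Finset.range (n + 1), (latticeRevPoly b T).coeff i * PowerSeries.coeff (n - i) (dodgerH b T) =
      (nodeRevPoly T).coeff n := by
  have h := congrArg (fun φ : PowerSeries ℂ => PowerSeries.coeff n φ) (latticeRevPoly_mul_dodgerH b T)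
  simp only [PowerSeries.coeff_mul, Polynomial.coeff_coe] at h
  rw [Finset.Nat.sum_antidiagonal_eq_sum_range_succ_mk] at h
  exact h

/-- `h_0 = 1`. [folklore] -/
theorem coeff_zero_dodgerH (b T : ℝ) : PowerSeries.coeff 0 (dodgerH b T) = 1 := by
  have h := dodgerH_recursion b T 0
  rw [zero_add, Finset.sum_range_one, Nat.sub_self, coeff_latticeRevPoly_zero, one_mul, coeff_nodeRevPoly_zero] at h
  exact h

/-- **The moments are the coefficients of `H`.** For every `n`: `M_n = [n = 0] − c_∞·h_n`. [this track, ATTEMPT-18 §3 D1 (δ′)] -/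
theorem dodgerMoment_eq {b : ℝ} (hb : 0 < b) (T : ℝ) (n : ℕ) :
    dodgerMoment b T n = (if n = 0 then 1 else 0) - dodgerCinfC b T * PowerSeries.coeff n (dodgerH b T) := by
  induction n using Nat.strong_induction_on with
  | _ n ih =>
    have hM := dodgerMoment_recursion hb T n
    have hH := dodgerH_recursion b T n
    -- split off the `i = 0` terms (`λ̃_0 = 1`)
    rw [Finset.sum_range_succ', coeff_latticeRevPoly_zero, one_mul, Nat.sub_zero] at hM hH
    -- the other terms are known by induction
    have hrest : ∑ i ∈ Finset.range n, (latticeRevPoly b T).coeff (i + 1) * dodgerMoment b T (n - (i + 1)) =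
        ∑ i ∈ Finset.range n, (latticeRevPoly b T).coeff (i + 1) *
          ((if n - (i + 1) = 0 then 1 else 0) - dodgerCinfC b T * PowerSeries.coeff (n - (i + 1)) (dodgerH b T)) :=
      Finset.sum_congr rfl fun i hi => by rw [ih (n - (i + 1)) (by have := Finset.mem_range.1 hi; omega)]
    rw [hrest] at hM
    -- the Kronecker terms: only `i = n − 1` survives, giving `λ̃_n` when `n ≥ 1`
    have hδ : ∑ i ∈ Finset.range n, (latticeRevPoly b T).coeff (i + 1) * ((if n - (i + 1) = 0 then (1 : ℂ) else 0)) =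
        if n = 0 then 0 else (latticeRevPoly b T).coeff n := by
      rcases Nat.eq_zero_or_pos n with hn | hn
      · subst hn; simp
      · rw [if_neg hn.ne', Finset.sum_eq_single (n - 1)]
        · rw [show n - 1 + 1 = n by omega, if_pos (by omega), mul_one]
        · intro i hi hne
          have hi' := Finset.mem_range.1 hi
          rw [if_neg (by omega), mul_zero]
        · intro h; exact absurd (Finset.mem_range.2 (by omega)) h
    have hsplit : ∑ i ∈ Finset.range n, (latticeRevPoly b T).coeff (i + 1) *
          ((if n - (i + 1) = 0 then 1 else 0) - dodgerCinfC b T * PowerSeries.coeff (n - (i + 1)) (dodgerH b T)) =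
        (if n = 0 then 0 else (latticeRevPoly b T).coeff n) -
          dodgerCinfC b T * ∑ i ∈ Finset.range n, (latticeRevPoly b T).coeff (i + 1) * PowerSeries.coeff (n - (i + 1)) (dodgerH b T) := by
      rw [← hδ, Finset.mul_sum, ← Finset.sum_sub_distrib]
      exact Finset.sum_congr rfl fun i _ => by ring
    rw [hsplit] at hM
    -- now solve for `M_n`
    rcases Nat.eq_zero_or_pos n with hn | hn
    · subst hn
      simp only [if_true] at hM ⊢
      simp only [Finset.range_zero, Finset.sum_empty] at hM hH
      rw [coeff_latticeRevPoly_zero, coeff_nodeRevPoly_zero] at hM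
      rw [coeff_nodeRevPoly_zero] at hH
      linear_combination hM + dodgerCinfC b T * hH
    · rw [if_neg hn.ne'] at hM ⊢
      linear_combination hM + dodgerCinfC b T * hH

/-- In particular `M_{n+1} = −c_∞·h_{n+1}`. [this track, ATTEMPT-18 §3 D1 (δ′)] -/
theorem dodgerMoment_succ_eq {b : ℝ} (hb : 0 < b) (T : ℝ) (n : ℕ) :
    dodgerMoment b T (n + 1) = -(dodgerCinfC b T * PowerSeries.coeff (n + 1) (dodgerH b T)) := by
  rw [dodgerMoment_eq hb T (n + 1), if_neg (Nat.succ_ne_zero n), zero_sub]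

/-! ## Merged part: HANDOFF — NEWTON'S RECURSION for the dodger's moment series and the cumulant form `H = e^{−p₁X}·R` (rh-explicit, track «HANDOFF», seat prove-2 gen10, ATTEMPT-19 §1)

(Originally a separate file of this track; its module docstring is kept with the HOME copy. Nothing here bears on the truth of RH.) -/

open scoped PowerSeries ComplexConjugate Real

/-! ## Definitions -/

/-- The generating series of the power sums: `Q = Σ_j S_{j+1}X^j`. [this track, ATTEMPT-19 §1] -/
def dodgerQ (b T : ℝ) : PowerSeries ℂ := PowerSeries.mk fun j => dodgerPowerSum b T (j + 1)

/-- The geometric series `Σ aⁿXⁿ = (1 − aX)⁻¹`. [folklore] -/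
def geomSeries (a : ℂ) : PowerSeries ℂ := PowerSeries.mk fun n => a ^ n

/-- The exponential series `Σ aⁿXⁿ/n! = e^{aX}`. [folklore] -/
def expSeries (a : ℂ) : PowerSeries ℂ := PowerSeries.mk fun n => a ^ n / (n.factorial : ℂ)

/-- The CUMULANT FORM of the moment series: `R = e^{S_1X}·H` (so `H = e^{−p₁X}·R`). [this track, ATTEMPT-16 §5 Lemma D1; ATTEMPT-19 §1] -/
def dodgerR (b T : ℝ) : PowerSeries ℂ := expSeries (dodgerPowerSum b T 1) * dodgerH b T

/-! ## Geometric and exponential series -/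

/-- `(1 − aX)·Σ aⁿXⁿ = 1`. [folklore] -/
theorem one_sub_mul_geomSeries (a : ℂ) : (1 - PowerSeries.C a * PowerSeries.X) * geomSeries a = 1 := by
  ext n
  rw [sub_mul, one_mul, mul_assoc, map_sub, PowerSeries.coeff_C_mul]
  cases n with
  | zero => simp [geomSeries]
  | succ n =>
    rw [PowerSeries.coeff_succ_X_mul, PowerSeries.coeff_one, if_neg (Nat.succ_ne_zero n)]
    simp only [geomSeries, PowerSeries.coeff_mk, pow_succ]
    ring

/-- `[Xʲ](C a · Σ aⁿXⁿ) = a^{j+1}`. [folklore] -/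
theorem coeff_C_mul_geomSeries (a : ℂ) (j : ℕ) :
    PowerSeries.coeff j (PowerSeries.C a * geomSeries a) = a ^ (j + 1) := by
  rw [PowerSeries.coeff_C_mul, geomSeries, PowerSeries.coeff_mk, pow_succ']

/-- `d(e^{aX}) = a·e^{aX}`. [folklore] -/
theorem derivative_expSeries (a : ℂ) : d⁄dX ℂ (expSeries a) = PowerSeries.C a * expSeries a := by
  ext n
  rw [PowerSeries.coeff_derivative, PowerSeries.coeff_C_mul, expSeries, PowerSeries.coeff_mk, PowerSeries.coeff_mk]
  have h1 : ((n + 1).factorial : ℂ) = ((n : ℂ) + 1) * (n.factorial : ℂ) := by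
    rw [Nat.factorial_succ]; push_cast; ring
  have h2 : (n.factorial : ℂ) ≠ 0 := by exact_mod_cast (Nat.factorial_pos n).ne'
  have h3 : ((n : ℂ) + 1) ≠ 0 := by exact_mod_cast Nat.succ_ne_zero n
  rw [h1, pow_succ]
  field_simp

/-- `expSeries a = rescale a exp`. [folklore] -/
theorem expSeries_eq_rescale (a : ℂ) : expSeries a = PowerSeries.rescale a (PowerSeries.exp ℂ) := by
  ext n
  rw [expSeries, PowerSeries.coeff_mk, PowerSeries.coeff_rescale, PowerSeries.coeff_exp]
  simp [div_eq_mul_inv]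

/-- `e^{aX}·e^{−aX} = 1`. [folklore] -/
theorem expSeries_mul_expSeries_neg (a : ℂ) : expSeries a * expSeries (-a) = 1 := by
  rw [expSeries_eq_rescale, expSeries_eq_rescale, PowerSeries.exp_mul_exp_eq_exp_add, add_neg_cancel,
    PowerSeries.rescale_zero_apply, PowerSeries.constantCoeff_exp, map_one]

/-- `[X⁰]e^{aX} = 1`. [folklore] -/
theorem coeff_zero_expSeries (a : ℂ) : PowerSeries.coeff 0 (expSeries a) = 1 := by
  simp [expSeries]

/-! ## The logarithmic derivative of a product of powers of linear factors -/

/-- `d(1 − cX) = −c`. [folklore] -/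
theorem derivative_one_sub_C_mul_X (c : ℂ) :
    d⁄dX ℂ (1 - PowerSeries.C c * PowerSeries.X) = -PowerSeries.C c := by
  rw [map_sub, Derivation.map_one_eq_zero, Derivation.leibniz, PowerSeries.derivative_X, PowerSeries.derivative_C,
    smul_zero, add_zero, smul_eq_mul, mul_one, zero_sub]

/-- **Logarithmic derivative**: `d(Π_{i∈s}(1 − c_iX)^{m_i}) = −Π_{i∈s}(1 − c_iX)^{m_i} · Σ_{i∈s} m_i·c_i·Σ_n c_iⁿXⁿ`. [folklore] -/
theorem derivative_prod_one_sub_pow {ι : Type*} [DecidableEq ι] (s : Finset ι) (c : ι → ℂ) (m : ι → ℕ) :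
    d⁄dX ℂ (∏ i ∈ s, (1 - PowerSeries.C (c i) * PowerSeries.X) ^ m i) =
      -((∏ i ∈ s, (1 - PowerSeries.C (c i) * PowerSeries.X) ^ m i) *
        ∑ i ∈ s, (m i : PowerSeries ℂ) * (PowerSeries.C (c i) * geomSeries (c i))) := by
  induction s using Finset.induction_on with
  | empty => simp
  | insert a s ha ih =>
    rw [Finset.prod_insert ha, Finset.sum_insert ha, Derivation.leibniz, ih, Derivation.leibniz_pow,
      derivative_one_sub_C_mul_X, smul_eq_mul, smul_eq_mul, smul_neg, smul_eq_mul, nsmul_eq_mul]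
    set F := ∏ i ∈ s, (1 - PowerSeries.C (c i) * PowerSeries.X) ^ m i
    set Sg := ∑ i ∈ s, (m i : PowerSeries ℂ) * (PowerSeries.C (c i) * geomSeries (c i))
    set f := (1 - PowerSeries.C (c a) * PowerSeries.X) with hf
    have hgeom : f * geomSeries (c a) = 1 := one_sub_mul_geomSeries (c a)
    rcases Nat.eq_zero_or_pos (m a) with h0 | hpos
    · rw [h0]
      simp
    · have hpow : f ^ (m a - 1) = f ^ m a * geomSeries (c a) := by
        rw [← Nat.sub_add_cancel hpos, pow_succ, Nat.add_sub_cancel, mul_assoc, hgeom, mul_one]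
      rw [hpow]
      ring

/-! ## `dH = −H·Q` and Newton's recursion -/

/-- `Λ̃` as a power series is the product `Π_k(1 − ν_kX)`. [this track, ATTEMPT-19 §1] -/
theorem coe_latticeRevPoly (b T : ℝ) :
    ((latticeRevPoly b T : Polynomial ℂ) : PowerSeries ℂ) =
      ∏ k : Fin (zetaZeroCount T), (1 - PowerSeries.C ((((latticeFreq b (k.val + 1)) ^ 2 : ℝ) : ℂ)) * PowerSeries.X) ^ (1 : ℕ) := by
  rw [latticeRevPoly, ← Polynomial.coeToPowerSeries.ringHom_apply, map_prod]
  refine Finset.prod_congr rfl fun k _ => ?_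
  rw [pow_one, map_sub, map_one, map_mul, Polynomial.coeToPowerSeries.ringHom_apply,
    Polynomial.coeToPowerSeries.ringHom_apply, Polynomial.coe_C, Polynomial.coe_X]

/-- `P̃` as a power series is the product `Π_ρ(1 − z_ρ²X)^{m(ρ)}`. [this track, ATTEMPT-19 §1] -/
theorem coe_nodeRevPoly (T : ℝ) :
    ((nodeRevPoly T : Polynomial ℂ) : PowerSeries ℂ) =
      ∏ ρ ∈ zerosBetween 0 T, (1 - PowerSeries.C (dodgerNode ρ ^ 2) * PowerSeries.X) ^ (riemannZetaZeroOrder ρ).toNat := by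
  classical
  rw [nodeRevPoly, ← Polynomial.coeToPowerSeries.ringHom_apply, map_prod]
  refine Finset.prod_congr rfl fun ρ _ => ?_
  rw [map_pow, map_sub, map_one, map_mul, Polynomial.coeToPowerSeries.ringHom_apply,
    Polynomial.coeToPowerSeries.ringHom_apply, Polynomial.coe_C, Polynomial.coe_X]

/-- The coefficients of `Q`: `[Xʲ]Q = S_{j+1}`, and `Q = Σ_ρ m z_ρ²·Σ(z_ρ²X)ⁿ − Σ_k ν_k·Σ(ν_kX)ⁿ`. [this track, ATTEMPT-19 §1] -/
theorem dodgerQ_eq (b T : ℝ) :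
    dodgerQ b T =
      ∑ ρ ∈ zerosBetween 0 T, ((riemannZetaZeroOrder ρ).toNat : PowerSeries ℂ) *
          (PowerSeries.C (dodgerNode ρ ^ 2) * geomSeries (dodgerNode ρ ^ 2)) -
        ∑ k : Fin (zetaZeroCount T), ((1 : ℕ) : PowerSeries ℂ) *
          (PowerSeries.C ((((latticeFreq b (k.val + 1)) ^ 2 : ℝ) : ℂ)) *
            geomSeries ((((latticeFreq b (k.val + 1)) ^ 2 : ℝ) : ℂ))) := by
  ext j
  rw [dodgerQ, PowerSeries.coeff_mk, dodgerPowerSum, map_sub, map_sum, map_sum]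
  congr 1
  · refine Finset.sum_congr rfl fun ρ _ => ?_
    rw [show ((riemannZetaZeroOrder ρ).toNat : PowerSeries ℂ) = PowerSeries.C (((riemannZetaZeroOrder ρ).toNat : ℂ)) by
      rw [map_natCast], PowerSeries.coeff_C_mul, coeff_C_mul_geomSeries]
  · rw [← Fin.sum_univ_eq_sum_range (fun k => ((((π * ((k + 1 : ℕ) : ℝ) / b) ^ 2 : ℝ)) : ℂ) ^ (j + 1)) (zetaZeroCount T)]
    refine Finset.sum_congr rfl fun k _ => ?_
    rw [Nat.cast_one, one_mul, coeff_C_mul_geomSeries]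
    rfl

/-- **`dH = −H·Q`.** [this track, ATTEMPT-19 §1; folklore (logarithmic derivative)] -/
theorem derivative_dodgerH (b T : ℝ) : d⁄dX ℂ (dodgerH b T) = -(dodgerH b T * dodgerQ b T) := by
  classical
  set Λ := ((latticeRevPoly b T : Polynomial ℂ) : PowerSeries ℂ) with hΛdef
  set P := ((nodeRevPoly T : Polynomial ℂ) : PowerSeries ℂ) with hPdef
  set QΛ := ∑ k : Fin (zetaZeroCount T), ((1 : ℕ) : PowerSeries ℂ) *
      (PowerSeries.C ((((latticeFreq b (k.val + 1)) ^ 2 : ℝ) : ℂ)) * geomSeries ((((latticeFreq b (k.val + 1)) ^ 2 : ℝ) : ℂ)))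
    with hQΛ
  set QP := ∑ ρ ∈ zerosBetween 0 T, ((riemannZetaZeroOrder ρ).toNat : PowerSeries ℂ) *
      (PowerSeries.C (dodgerNode ρ ^ 2) * geomSeries (dodgerNode ρ ^ 2)) with hQP
  have hΛ0 : PowerSeries.constantCoeff Λ ≠ 0 := by
    rw [hΛdef, constantCoeff_latticeRevPoly]; exact one_ne_zero
  have hinv : Λ⁻¹ * Λ = 1 := PowerSeries.inv_mul_cancel _ hΛ0
  have hdΛ : d⁄dX ℂ Λ = -(Λ * QΛ) := by
    rw [hΛdef, coe_latticeRevPoly]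
    exact derivative_prod_one_sub_pow _ _ _
  have hdP : d⁄dX ℂ P = -(P * QP) := by
    rw [hPdef, coe_nodeRevPoly]
    exact derivative_prod_one_sub_pow _ _ _
  have hH : dodgerH b T = P * Λ⁻¹ := rfl
  have hQ : dodgerQ b T = QP - QΛ := dodgerQ_eq b T
  rw [hH, hQ, Derivation.leibniz, (PowerSeries.derivative ℂ).leibniz_of_mul_eq_one hinv, hdΛ, hdP, smul_eq_mul, smul_eq_mul,
    smul_eq_mul]
  linear_combination (P * Λ⁻¹ * QΛ) * hinv

/-- **Newton's recursion**: `(n+1)·h_{n+1} = −Σ_{j≤n} S_{j+1}·h_{n−j}`. [this track, ATTEMPT-19 §1; folklore (Newton's identities)] -/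
theorem dodgerH_newton (b T : ℝ) (n : ℕ) :
    ((n : ℂ) + 1) * PowerSeries.coeff (n + 1) (dodgerH b T) =
      -∑ j ∈ Finset.range (n + 1), dodgerPowerSum b T (j + 1) * PowerSeries.coeff (n - j) (dodgerH b T) := by
  have h := congrArg (fun φ => PowerSeries.coeff n φ) (derivative_dodgerH b T)
  simp only [PowerSeries.coeff_derivative, map_neg] at h
  rw [mul_comm (dodgerH b T), PowerSeries.coeff_mul, Finset.Nat.sum_antidiagonal_eq_sum_range_succ
    (fun i j => PowerSeries.coeff i (dodgerQ b T) * PowerSeries.coeff j (dodgerH b T))] at h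
  simp only [dodgerQ, PowerSeries.coeff_mk] at h
  rw [mul_comm]
  exact h

/-! ## The cumulant form `R = e^{S_1X}·H` -/

/-- `dR = −R·(Q − S_1)`. [this track, ATTEMPT-19 §1] -/
theorem derivative_dodgerR (b T : ℝ) :
    d⁄dX ℂ (dodgerR b T) = -(dodgerR b T * (dodgerQ b T - PowerSeries.C (dodgerPowerSum b T 1))) := by
  rw [dodgerR, Derivation.leibniz, derivative_dodgerH, derivative_expSeries, smul_eq_mul, smul_eq_mul]
  ring

/-- `r_0 = 1`. [this track, ATTEMPT-19 §1] -/
theorem coeff_zero_dodgerR (b T : ℝ) : PowerSeries.coeff 0 (dodgerR b T) = 1 := by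
  rw [dodgerR, PowerSeries.coeff_mul, Finset.Nat.antidiagonal_zero, Finset.sum_singleton, coeff_zero_expSeries,
    coeff_zero_dodgerH, mul_one]

/-- **The cumulant recursion**: `(n+1)·r_{n+1} = −Σ_{i<n} S_{i+2}·r_{n−1−i}` — hypothesis `hrec` of `norm_le_majorSeq`.
[this track, ATTEMPT-16 §5 Lemma D1; ATTEMPT-19 §1] -/
theorem dodgerR_recursion (b T : ℝ) (n : ℕ) :
    ((n : ℂ) + 1) * PowerSeries.coeff (n + 1) (dodgerR b T) =
      -∑ i ∈ Finset.range n, dodgerPowerSum b T (i + 2) * PowerSeries.coeff (n - 1 - i) (dodgerR b T) := by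
  have h := congrArg (fun φ => PowerSeries.coeff n φ) (derivative_dodgerR b T)
  simp only [PowerSeries.coeff_derivative, map_neg] at h
  rw [mul_comm (dodgerR b T), PowerSeries.coeff_mul, Finset.Nat.sum_antidiagonal_eq_sum_range_succ
    (fun i j => PowerSeries.coeff i (dodgerQ b T - PowerSeries.C (dodgerPowerSum b T 1)) * PowerSeries.coeff j (dodgerR b T)),
    Finset.sum_range_succ'] at h
  have h0 : PowerSeries.coeff 0 (dodgerQ b T - PowerSeries.C (dodgerPowerSum b T 1)) = 0 := by
    rw [map_sub, dodgerQ, PowerSeries.coeff_mk, PowerSeries.coeff_zero_C, zero_add, sub_self]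
  have hk : ∀ k : ℕ, PowerSeries.coeff (k + 1) (dodgerQ b T - PowerSeries.C (dodgerPowerSum b T 1)) = dodgerPowerSum b T (k + 2) := by
    intro k
    rw [map_sub, dodgerQ, PowerSeries.coeff_mk, PowerSeries.coeff_C, if_neg (Nat.succ_ne_zero k), sub_zero]
  simp only [h0, zero_mul, add_zero, hk] at h
  rw [mul_comm, h]
  congr 1
  refine Finset.sum_congr rfl fun i _ => ?_
  rw [show n - (i + 1) = n - 1 - i by omega]

/-- `H = e^{−S_1X}·R`. [this track, ATTEMPT-19 §1] -/
theorem dodgerH_eq_expSeries_mul_dodgerR (b T : ℝ) :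
    dodgerH b T = expSeries (-dodgerPowerSum b T 1) * dodgerR b T := by
  rw [dodgerR, ← mul_assoc, mul_comm (expSeries _) (expSeries _), expSeries_mul_expSeries_neg, one_mul]

/-- **`h_n = Σ_{j≤n} (−S_1)^{n−j}/(n−j)!·r_j`** — hypothesis `hconv` of `norm_sub_le_mul_expm1` (with `S_1 = p₁` real, below).
[this track, ATTEMPT-16 §5 Lemma D1 (i); ATTEMPT-19 §1] -/
theorem coeff_dodgerH_eq_sum (b T : ℝ) (n : ℕ) :
    PowerSeries.coeff n (dodgerH b T) =
      ∑ j ∈ Finset.range (n + 1), (-dodgerPowerSum b T 1) ^ (n - j) / ((n - j).factorial : ℂ) *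
        PowerSeries.coeff j (dodgerR b T) := by
  rw [dodgerH_eq_expSeries_mul_dodgerR, PowerSeries.coeff_mul,
    Finset.Nat.sum_antidiagonal_eq_sum_range_succ
      (fun i j => PowerSeries.coeff i (expSeries (-dodgerPowerSum b T 1)) * PowerSeries.coeff j (dodgerR b T)),
    ← Finset.sum_range_reflect]
  refine Finset.sum_congr rfl fun j hj => ?_
  have hj' : j ≤ n := Nat.lt_succ_iff.1 (Finset.mem_range.1 hj)
  simp only [expSeries, PowerSeries.coeff_mk, Nat.succ_sub_one, Nat.sub_sub_self hj']

/-! ## Realness of the power sums -/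

/-- The power sums are real: `conj S_j = S_j` (the killed multiset is closed under `ρ ↦ 1 − ρ̄`, which conjugates the node).
[this track, ATTEMPT-18 (D-3); ATTEMPT-19 §1] -/
theorem conj_dodgerPowerSum (b T : ℝ) (j : ℕ) : conj (dodgerPowerSum b T j) = dodgerPowerSum b T j := by
  rw [dodgerPowerSum, map_sub, map_sum, map_sum]
  congr 1
  · -- reindex by the involution `ρ ↦ 1 − ρ̄`
    symm
    refine Finset.sum_nbij' (fun ρ => 1 - conj ρ) (fun ρ => 1 - conj ρ) (fun ρ hρ => one_sub_conj_mem_zerosBetween hρ)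
      (fun ρ hρ => one_sub_conj_mem_zerosBetween hρ) (fun ρ _ => by simp) (fun ρ _ => by simp) fun ρ hρ => ?_
    rw [map_mul, map_natCast, map_pow, map_pow, zeroOrder_one_sub_conj hρ, dodgerNode_one_sub_conj, Complex.conj_conj]
  · refine Finset.sum_congr rfl fun k _ => ?_
    rw [map_pow, Complex.conj_ofReal]

/-- `S_j = (Re S_j : ℂ)`. [this track, ATTEMPT-19 §1] -/
theorem dodgerPowerSum_eq_ofReal (b T : ℝ) (j : ℕ) : dodgerPowerSum b T j = (((dodgerPowerSum b T j).re : ℝ) : ℂ) :=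
  (Complex.conj_eq_iff_re.1 (conj_dodgerPowerSum b T j)).symm

/-- The cumulant recursion and the convolution identity in the exact shape consumed by `HandoffDodgerMajorant`
(`hrec`, `hconv` with the REAL first power sum `p₁ = Re S_1`). [this track, ATTEMPT-19 §1–§2] -/
theorem dodgerH_cumulant_form (b T : ℝ) :
    PowerSeries.coeff 0 (dodgerR b T) = 1 ∧
    (∀ n : ℕ, ((n : ℂ) + 1) * PowerSeries.coeff (n + 1) (dodgerR b T) =
      -∑ i ∈ Finset.range n, dodgerPowerSum b T (i + 2) * PowerSeries.coeff (n - 1 - i) (dodgerR b T)) ∧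
    (∀ n : ℕ, PowerSeries.coeff n (dodgerH b T) =
      ∑ j ∈ Finset.range (n + 1), ((-(dodgerPowerSum b T 1).re : ℝ) : ℂ) ^ (n - j) / ((n - j).factorial : ℂ) *
        PowerSeries.coeff j (dodgerR b T)) := by
  refine ⟨coeff_zero_dodgerR b T, dodgerR_recursion b T, fun n => ?_⟩
  rw [coeff_dodgerH_eq_sum]
  refine Finset.sum_congr rfl fun j _ => ?_
  rw [Complex.ofReal_neg, ← dodgerPowerSum_eq_ofReal]

end Summit.RiemannHypothesis.RiemannHypothesis.Theorems.Handoff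

end
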